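import Summits.QuantumFields.YangMills.Theorems.BalabanUVNodesN11OldBranchCondExpOfFluctuationSlicesAtRePinH
import Summits.QuantumFields.YangMills.Theorems.BalabanUVNodesN11StepWeightSupportOfRecord

/-!
# DAG node N11 — `hce₀` AT `rePinH θ` WITH THE SUPPORT CLAUSE CUT IN TWO: core provisos of `θ` + term rows + a fluctuation-product socket + `0 < sideD` + the BRIDGE
# ((3.2)∕(3.3) events ⇒ charted set) + (hIslice) + THE PER-SLICE (3.23) IDENTITY — def-T's half of the support clause discharged by dag-n11-w2 g4's `support_of_wOfRecord_ne_zero`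

HEADER — WORK-UNIT METADATA.  Cell `pub-ymgap`, YM-PLAN Track A (HUMAN RULING D-0062), WIDTH SEAT `pub-ymgap-dag-n11-w6` (g3; R399 (3a) re-mint) on NODE n11 [B14],
route `BalabanUVNodes` rev 29, jail key K1⁷ `StabilityBAtRecordR13SepCoPH` = stmt-QuantumFields-20542 (helper lane, `--kind proof --supports stmt-QuantumFields-20542 --as helper`,
count-neutral; K1⁹ = stmt-QuantumFields-27364 of record — dag-lead KEY MAP v2, MIS-KEY rule R463 (4)(a)).  [I] = [Balaban1987RG1], [III] = [Balaban1988Convergent].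
ONE composition BY NAME of this seat's `…OldBranchCondExpOfFluctuationSlicesAtRePinH` §2 (`oldBranchCondExp₁₃H_of_fluctuationSlices_rePinH_of_termRows`) with dag-n11-w2 g4's
`…N11StepWeightSupportOfRecord.support_of_wOfRecord_ne_zero` (p638096) at the re-pinned parameter.

WHY THIS FILE.  The end of this seat's `hce₀` road at the Lie-algebra-coordinate socket, in the letters dag-n11-d g16's `supplierObligations_rePinH_of_bounds_of_condExp` reads:
every displayed hypothesis is now either a core proviso of `θ`, Theorem 1's inductive form, the supplier's own term rows, the guard `𝐓ρ_k(s′) ≢ 0`, the numerics `0 < sideD`, or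
CHART-SIDE: the socket data `(κ₂, Ψ, J, S; hΨ hJ hpush hfib)` (the (47)∕Lie–Haar chart — director's∕chair's lever), the BRIDGE «the chart's charted set covers the configurations
where the (3.2) plaquette-smallness and (3.3) small-approximate-fluctuation events hold at every χ-cube of `Ω_{k+1}(s′)`» (background regularity in plaquette currency — LOCATED),
the chart-side integrability (hIslice), and THE PER-FLUCTUATION-SLICE IDENTITY (hslice) = [III] p.267 L.18–30 ∘ (3.16)–(3.22) ∘ Thm 2.

WHAT THIS FILE PROVES (0 `def`, 0 `sorry`, standard axioms).  ★★ `oldBranchCondExp₁₃H_of_fluctuationSlices_rePinH_of_support_of_termRows`.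

HONEST FRAMING.  Helper lane, count-neutral; ONE composition BY NAME; bridge ∕ socket data ∕ term rows ∕ (hIslice) ∕ the per-slice identity are HYPOTHESES; NO chart of
Bałaban's ((47), [III] (3.10)–(3.25)) asserted; NO Jacobian evaluated; NO Gaussian integration performed; nothing of [I] §2 ∕ [III] §3 ∕ Thm 2 asserted; (B4) ∕ (S-α) ∕ (O3′) NOT
closed; N11 NOT discharged; K1⁷ ∕ K1⁹ NOT closed, no registered stub touched; counts unmoved (typed 28∕28 · discharged 5∕27 · A 5∕28).  One finite `𝕋⁴_{L^K}` programme at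
fixed `ε = L^{−K}`; R4 closes only the conditional finite-𝕋⁴ rung `BalabanLadder.UV` — NOT ℝ⁴, NOT OS, NOT a mass gap, NOT Clay.  No `sorry`, `axiom`, `def`, `instance`,
`notation`.  Sources (SHAPE ∕ bookkeeping only): [I] (0.4) p.253, §2 p.267; [III] Thm 1 p.262, Thm 2 p.263, (2.18) p.257, (2.20)–(2.21) p.258, (3.1) p.264, (3.2)–(3.5) p.265,
(3.23)–(3.25) p.270, §3 p.279.
-/

noncomputable section

open MeasureTheory ProbabilityTheory
open scoped ENNReal NNReal BigOperators Matrix.Norms.L2Operator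

namespace Summit.QuantumFields.YangMills.Theorems.BalabanUVNodesN11OldBranchCondExpOfFluctuationSlicesAtRePinHOfSupport

open Literature.MathematicalPhysics.QuantumFieldTheory.Balaban1983to89
open Literature.MathematicalPhysics.QuantumFieldTheory.Balaban1983to89.T4AveragingDisintegration
open BalabanUVNodesN11OldBranchCondExpOfFluctuationSlicesAtRePinH (oldBranchCondExp₁₃H_of_fluctuationSlices_rePinH_of_termRows)
open BalabanUVNodesN11StepWeightSupportOfRecord (support_of_wOfRecord_ne_zero)
open BalabanUVNodesN11Sect3SupplyChainTermRows (TermRowsAt)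
open BalabanUVNodesN11RePinnedParamDefs (rePinH)
open Node00 hiding SU
open Node00.Tk T4Continuum B14.Eq218Concrete B14.Sect3Decomp
open B10Eq42TorusConstraint (bondsIn)
open T4AdjointCovariance (insA)

variable {F : T4Family} {N : ℕ} [NeZero N]

/-- ★★ **`hce₀` AT `rePinH θ`, SUPPORT CLAUSE CUT IN TWO** — `…AtRePinH` §2 with E's support clause `hwS` REPLACED by `hD : 0 < sideD` + `hbridge` (events ⇒ charted set);
`hwS` derived by contraposition through dag-n11-w2 g4's `support_of_wOfRecord_ne_zero` at `rePinH θ`. [cite: Balaban1988Convergent, Thm 2 p.263, (3.2)–(3.5) p.265, (3.23)–(3.25) p.270, §3 p.279] -/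
theorem oldBranchCondExp₁₃H_of_fluctuationSlices_rePinH_of_support_of_termRows (θ : Stage13HParams F N) (h : θ.Provisos₁₃CoPH F N)
    (p : B12.RunParams) {k : ℕ} (hkK : k < p.K)
    {hdec : DecidableEq (PBond (F.P p.K) k)} {hdec' : DecidableEq (PBond (F.P p.K) (k + 1))} (hk : k + 1 ≤ (F.P p.K).m + (F.P p.K).K)
    (s' : SeqOfRecord F (rePinH θ).ν (rePinH θ).τ9.M (gOfRecord₁₃ F N (rePinH θ).toStage13Params p) p.K (k + 1))
    {law : SeqOfRecord F (rePinH θ).ν (rePinH θ).τ9.M (gOfRecord₁₃ F N (rePinH θ).toStage13Params p) p.K k → Sect2.TermValues (F.P p.K) (MatA N) (FluctV N) (rePinH θ).τ9.M → Prop}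
    {t : SeqOfRecord F (rePinH θ).ν (rePinH θ).τ9.M (gOfRecord₁₃ F N (rePinH θ).toStage13Params p) p.K k → Sect2.TermValues (F.P p.K) (MatA N) (FluctV N) (rePinH θ).τ9.M}
    {Ek : SeqOfRecord F (rePinH θ).ν (rePinH θ).τ9.M (gOfRecord₁₃ F N (rePinH θ).toStage13Params p) p.K k → ℝ}
    (hform : HasSect2FormAtZS F N (FluctV N) p.K (settingOfRecord₁₃ F N (rePinH θ).toStage13Params p) k ((rePinH θ).rzAt p) (WtOfRecord₁₃H F N (rePinH θ) p)
      (UbgOfRecord₁₃CoP F N (rePinH θ).toStage13Params p k) law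
      (slotsOfRecord F N (rePinH θ).ν (rePinH θ).τ9 (EOfRecord₁₃ F N (rePinH θ).toStage13Params) (wOfRecord₉ F N (rePinH θ).toStage9Params) (rePinH θ).ppSel p (gOfRecord₁₃ F N (rePinH θ).toStage13Params p) k) t Ek)
    -- the child is 𝐓-PRESENT with a non-trivial 𝐓-image (else nothing is asked: dag-n11-d g16's `hce` family is guarded by `𝐓ρ_k(s′) ≢ 0`)
    (hT : slotsTOfRecord F N (rePinH θ).ν (rePinH θ).τ9 (EOfRecord₁₃ F N (rePinH θ).toStage13Params) (wOfRecord₉ F N (rePinH θ).toStage9Params) (rePinH θ).ppSel p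
      (gOfRecord₁₃ F N (rePinH θ).toStage13Params p) (k + 1) s' ≠ 0)
    (t' : Sect2.TermValues (F.P p.K) (MatA N) (FluctV N) (rePinH θ).τ9.M) (E' : ℝ)
    {X₂ : Type*} [MeasurableSpace X₂] (κ₂ : Kernel (((↥(Set.toFinite (bondsIn k (s'.Ω (k + 1))ᶜ)).toFinset → SU N) × ({c : PBond (F.P p.K) (k + 1) // c ∉ (Set.toFinite (bondsIn (k + 1) (s'.Ω (k + 1))ᶜ)).toFinset} → SU N)) × (↥(Set.toFinite (bondsIn k ((s'.Λ (k + 1))ᶜ ∩ s'.Ω (k + 1)))).toFinset → FluctV N)) X₂) [IsSFiniteKernel κ₂]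
    {Ψ : ((↥(Set.toFinite (bondsIn k (s'.Ω (k + 1))ᶜ)).toFinset → SU N) × ({c : PBond (F.P p.K) (k + 1) // c ∉ (Set.toFinite (bondsIn (k + 1) (s'.Ω (k + 1))ᶜ)).toFinset} → SU N)) × ((↥(Set.toFinite (bondsIn k ((s'.Λ (k + 1))ᶜ ∩ s'.Ω (k + 1)))).toFinset → FluctV N) × X₂) → (↥(Set.toFinite (bondsIn k (s'.Ω (k + 1))ᶜ)).toFinset → SU N) × ({b : PBond (F.P p.K) k // b ∉ (Set.toFinite (bondsIn k (s'.Ω (k + 1))ᶜ)).toFinset} → SU N)} (hΨ : Measurable Ψ)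
    {J : ((↥(Set.toFinite (bondsIn k (s'.Ω (k + 1))ᶜ)).toFinset → SU N) × ({c : PBond (F.P p.K) (k + 1) // c ∉ (Set.toFinite (bondsIn (k + 1) (s'.Ω (k + 1))ᶜ)).toFinset} → SU N)) × ((↥(Set.toFinite (bondsIn k ((s'.Λ (k + 1))ᶜ ∩ s'.Ω (k + 1)))).toFinset → FluctV N) × X₂) → ℝ≥0} (hJ : Measurable J) {S : Set ((↥(Set.toFinite (bondsIn k (s'.Ω (k + 1))ᶜ)).toFinset → SU N) × ({b : PBond (F.P p.K) k // b ∉ (Set.toFinite (bondsIn k (s'.Ω (k + 1))ᶜ)).toFinset} → SU N))}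
    (hpush : ((((Measure.pi fun _ : ↥(Set.toFinite (bondsIn k (s'.Ω (k + 1))ᶜ)).toFinset => (HaarData.haar : Measure (SU N))).prod
          (Measure.pi fun _ : {c : PBond (F.P p.K) (k + 1) // c ∉ (Set.toFinite (bondsIn (k + 1) (s'.Ω (k + 1))ᶜ)).toFinset} =>
            (HaarData.haar : Measure (SU N)))) ⊗ₘ (Kernel.const _ (Measure.pi fun _ : ↥(Set.toFinite (bondsIn k ((s'.Λ (k + 1))ᶜ ∩ s'.Ω (k + 1)))).toFinset => (volume : Measure (FluctV N))) ⊗ₖ κ₂)).withDensity (fun z => (J z : ℝ≥0∞))).map Ψ =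
      (((Measure.pi fun _ : ↥(Set.toFinite (bondsIn k (s'.Ω (k + 1))ᶜ)).toFinset => (HaarData.haar : Measure (SU N))).prod
          (Measure.pi fun _ : {b : PBond (F.P p.K) k // b ∉ (Set.toFinite (bondsIn k (s'.Ω (k + 1))ᶜ)).toFinset} => (HaarData.haar : Measure (SU N))))).restrict S)
    (hfib : ∀ᵐ z ∂((((Measure.pi fun _ : ↥(Set.toFinite (bondsIn k (s'.Ω (k + 1))ᶜ)).toFinset => (HaarData.haar : Measure (SU N))).prod
          (Measure.pi fun _ : {c : PBond (F.P p.K) (k + 1) // c ∉ (Set.toFinite (bondsIn (k + 1) (s'.Ω (k + 1))ᶜ)).toFinset} =>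
            (HaarData.haar : Measure (SU N)))) ⊗ₘ (Kernel.const _ (Measure.pi fun _ : ↥(Set.toFinite (bondsIn k ((s'.Λ (k + 1))ᶜ ∩ s'.Ω (k + 1)))).toFinset => (volume : Measure (FluctV N))) ⊗ₖ κ₂)).withDensity (fun z => (J z : ℝ≥0∞))),
      (fun q => (q.1, fun c : {c : PBond (F.P p.K) (k + 1) // c ∉ (Set.toFinite (bondsIn (k + 1) (s'.Ω (k + 1))ᶜ)).toFinset} =>
          (avOfRecord F N p.K k).avg
            ((MeasurableEquiv.piEquivPiSubtypeProd (fun _ : PBond (F.P p.K) k => SU N)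
              (· ∈ (Set.toFinite (bondsIn k (s'.Ω (k + 1))ᶜ)).toFinset)).symm q) c)) (Ψ z) = z.1)
    -- the support clause CUT IN TWO at `rePinH θ`: def-T's half is `support_of_wOfRecord_ne_zero` (under `0 < sideD`); displayed is only the BRIDGE events ⇒ charted set
    (hD : 0 < sideD F (rePinH θ).ν (rePinH θ).τ9.M p (gOfRecord₁₃ F N (rePinH θ).toStage13Params p) k)
    (hbridge : ∀ q : (↥(Set.toFinite (bondsIn k (s'.Ω (k + 1))ᶜ)).toFinset → SU N) × ({b : PBond (F.P p.K) k // b ∉ (Set.toFinite (bondsIn k (s'.Ω (k + 1))ᶜ)).toFinset} → SU N),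
      (∀ c ∈ cubesIn (cubeχ F (rePinH θ).ν p (gOfRecord₁₃ F N (rePinH θ).toStage13Params p) k) (s'.Ω (k + 1)),
        PlaqSmallOn ((sect3DataOfRecord F N (rePinH θ).ν (rePinH θ).τ9.M p (gOfRecord₁₃ F N (rePinH θ).toStage13Params p) k s'.init).plaqT c)
            (epsOfRecord (rePinH θ).ν (gOfRecord₁₃ F N (rePinH θ).toStage13Params p) (k + 1) * (F.P p.K).eta (k + 1) ^ 2)
            ((sect3DataOfRecord F N (rePinH θ).ν (rePinH θ).τ9.M p (gOfRecord₁₃ F N (rePinH θ).toStage13Params p) k s'.init).UkLoc c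
              ((avOfRecord F N p.K k).avg (⇑(MeasurableEquiv.piEquivPiSubtypeProd (fun _ : PBond (F.P p.K) k => SU N) (· ∈ (Set.toFinite (bondsIn k (s'.Ω (k + 1))ᶜ)).toFinset)).symm q))) ∧
          SmallApproxFluct (sect3DataOfRecord F N (rePinH θ).ν (rePinH θ).τ9.M p (gOfRecord₁₃ F N (rePinH θ).toStage13Params p) k s'.init) (avOfRecord F N p.K)
            (2 * deltaOfRecord (rePinH θ).ν (gOfRecord₁₃ F N (rePinH θ).toStage13Params p) k (rePinH θ).A₁)
            (⇑(MeasurableEquiv.piEquivPiSubtypeProd (fun _ : PBond (F.P p.K) k => SU N) (· ∈ (Set.toFinite (bondsIn k (s'.Ω (k + 1))ᶜ)).toFinset)).symm q)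
            ((avOfRecord F N p.K k).avg (⇑(MeasurableEquiv.piEquivPiSubtypeProd (fun _ : PBond (F.P p.K) k => SU N) (· ∈ (Set.toFinite (bondsIn k (s'.Ω (k + 1))ᶜ)).toFinset)).symm q)) c) →
        q ∈ S)
    -- dag-n11-w3's TERM ROWS at `rePinH θ` (residual measurability rows DISCHARGED at the re-pin: `measurable_zhAt_ζ0_rePinH_of_provisos` ∕ `measurable_zhAt_quad_rePinH`)
    (htrows₀ : ∀ j, 1 ≤ j → j ≤ k → TermRowsAt (rePinH θ) p (t s'.init) j) (htrows : ∀ j, 1 ≤ j → j ≤ k + 1 → TermRowsAt (rePinH θ) p t' j)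
    -- (a.1) the charted old-branch piece is integrable on the product fibre at every inside fine `y` on the averaging fibre (Fubini's proviso)
    (hIslice : ∀ᵐ q ∂((Measure.pi fun _ : ↥(Set.toFinite (bondsIn (k + 1) (s'.Ω (k + 1))ᶜ)).toFinset => (HaarData.haar : Measure (SU N))).prod
          (Measure.pi fun _ : {c : PBond (F.P p.K) (k + 1) // c ∉ (Set.toFinite (bondsIn (k + 1) (s'.Ω (k + 1))ᶜ)).toFinset} => (HaarData.haar : Measure (SU N)))),
      ∀ S₀ ∈ admSOfRecord F (rePinH θ).ν (rePinH θ).τ9.M (gOfRecord₁₃ F N (rePinH θ).toStage13Params p) p.K k s'.init, ∀ y : ↥(Set.toFinite (bondsIn k (s'.Ω (k + 1))ᶜ)).toFinset → SU N,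
        avgRestrOfRecord F N p.K k (Set.toFinite (bondsIn k (s'.Ω (k + 1))ᶜ)).toFinset (Set.toFinite (bondsIn (k + 1) (s'.Ω (k + 1))ᶜ)).toFinset y = q.1 →
        Integrable (fun x : ((↥(Set.toFinite (bondsIn k ((s'.Λ (k + 1))ᶜ ∩ s'.Ω (k + 1)))).toFinset → FluctV N) × X₂) => (J ((y, q.2), x) : ℝ) * ((fun U => wOfRecord₉ F N (rePinH θ).toStage9Params p (gOfRecord₁₃ F N (rePinH θ).toStage13Params p) k s' U ((avOfRecord F N p.K k).avg U) *
        (chiSeqOfRecord F N (rePinH θ).ν (rePinH θ).τ9.M (gOfRecord₁₃ F N (rePinH θ).toStage13Params p) p.K k s'.init U *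
          tkBranchOfRecord F N (FluctV N) (rePinH θ).ν (rePinH θ).τ9.M (gOfRecord₁₃ F N (rePinH θ).toStage13Params p) p.K (WtOfRecord₁₃H F N (rePinH θ) p s'.init) s'.init S₀ k (fun ω => (sect2Operand F N (FluctV N) p.K (settingOfRecord₁₃ F N (rePinH θ).toStage13Params p) ((rePinH θ).rzAt p s'.init) s'.init (t s'.init) (Ek s'.init)
            (UbgOfRecord₁₃CoP F N (rePinH θ).toStage13Params p k s'.init)) (S₀, fun j => (ω j).2) (fun j => (ω j).1)) (baseCfg k U))) ∘
          ⇑(MeasurableEquiv.piEquivPiSubtypeProd (fun _ : PBond (F.P p.K) k => SU N) (· ∈ (Set.toFinite (bondsIn k (s'.Ω (k + 1))ᶜ)).toFinset)).symm) (Ψ ((y, q.2), x))) ((Kernel.const _ (Measure.pi fun _ : ↥(Set.toFinite (bondsIn k ((s'.Λ (k + 1))ᶜ ∩ s'.Ω (k + 1)))).toFinset => (volume : Measure (FluctV N))) ⊗ₖ κ₂) (y, q.2)))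
    -- (b) THE PER-FLUCTUATION-SLICE IDENTITY ((3.23): the conditional `A_k|_{Λ_{k+1}}` integral of the charted old piece = ζ·χ·Gaussian weight·new operand) — displayed
    (hslice : ∀ᵐ q ∂((Measure.pi fun _ : ↥(Set.toFinite (bondsIn (k + 1) (s'.Ω (k + 1))ᶜ)).toFinset => (HaarData.haar : Measure (SU N))).prod
          (Measure.pi fun _ : {c : PBond (F.P p.K) (k + 1) // c ∉ (Set.toFinite (bondsIn (k + 1) (s'.Ω (k + 1))ᶜ)).toFinset} => (HaarData.haar : Measure (SU N)))),
      ∀ S₀ ∈ admSOfRecord F (rePinH θ).ν (rePinH θ).τ9.M (gOfRecord₁₃ F N (rePinH θ).toStage13Params p) p.K k s'.init, ∀ y : ↥(Set.toFinite (bondsIn k (s'.Ω (k + 1))ᶜ)).toFinset → SU N,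
        avgRestrOfRecord F N p.K k (Set.toFinite (bondsIn k (s'.Ω (k + 1))ᶜ)).toFinset (Set.toFinite (bondsIn (k + 1) (s'.Ω (k + 1))ᶜ)).toFinset y = q.1 →
        ∀ᵐ a ∂(Measure.pi fun _ : ↥(Set.toFinite (bondsIn k ((s'.Λ (k + 1))ᶜ ∩ s'.Ω (k + 1)))).toFinset => (volume : Measure (FluctV N))),
          ∫ x₂, (J ((y, q.2), (a, x₂)) : ℝ) * ((fun U => wOfRecord₉ F N (rePinH θ).toStage9Params p (gOfRecord₁₃ F N (rePinH θ).toStage13Params p) k s' U ((avOfRecord F N p.K k).avg U) *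
        (chiSeqOfRecord F N (rePinH θ).ν (rePinH θ).τ9.M (gOfRecord₁₃ F N (rePinH θ).toStage13Params p) p.K k s'.init U *
          tkBranchOfRecord F N (FluctV N) (rePinH θ).ν (rePinH θ).τ9.M (gOfRecord₁₃ F N (rePinH θ).toStage13Params p) p.K (WtOfRecord₁₃H F N (rePinH θ) p s'.init) s'.init S₀ k (fun ω => (sect2Operand F N (FluctV N) p.K (settingOfRecord₁₃ F N (rePinH θ).toStage13Params p) ((rePinH θ).rzAt p s'.init) s'.init (t s'.init) (Ek s'.init)
            (UbgOfRecord₁₃CoP F N (rePinH θ).toStage13Params p k s'.init)) (S₀, fun j => (ω j).2) (fun j => (ω j).1)) (baseCfg k U))) ∘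
          ⇑(MeasurableEquiv.piEquivPiSubtypeProd (fun _ : PBond (F.P p.K) k => SU N) (· ∈ (Set.toFinite (bondsIn k (s'.Ω (k + 1))ᶜ)).toFinset)).symm) (Ψ ((y, q.2), (a, x₂))) ∂(κ₂ ((y, q.2), a)) =
            (WtOfRecord₁₃H F N (rePinH θ) p s').ζ k (s'.Ω (k + 1))ᶜ
                (Function.update (baseCfg (k + 1) ((MeasurableEquiv.piEquivPiSubtypeProd (fun _ : PBond (F.P p.K) (k + 1) => SU N) (· ∈ (Set.toFinite (bondsIn (k + 1) (s'.Ω (k + 1))ᶜ)).toFinset)).symm q)) k (Function.updateFinset ((baseCfg (V := FluctV N) (k + 1) ((MeasurableEquiv.piEquivPiSubtypeProd (fun _ : PBond (F.P p.K) (k + 1) => SU N) (· ∈ (Set.toFinite (bondsIn (k + 1) (s'.Ω (k + 1))ᶜ)).toFinset)).symm q)) k).1 (Set.toFinite (bondsIn k (s'.Ω (k + 1))ᶜ)).toFinset y, ((baseCfg (V := FluctV N) (k + 1) ((MeasurableEquiv.piEquivPiSubtypeProd (fun _ : PBond (F.P p.K) (k + 1) => SU N) (· ∈ (Set.toFinite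 (bondsIn (k + 1) (s'.Ω (k + 1))ᶜ)).toFinset)).symm q)) k).2)) *
              ∑ Y ∈ (Set.toFinite {Y : Set (Site (F.P p.K) 0) | Y ∈ SClassOfRecord F (rePinH θ).ν (gOfRecord₁₃ F N (rePinH θ).toStage13Params p) p.K (k + 1) ∧ Y ⊆ s'.Ω (k + 1) ∩ (s'.Λ (k + 1))ᶜ}).toFinset,
                (WtOfRecord₁₃H F N (rePinH θ) p s').w k (s'.Λ (k + 1)) ((s'.Λ (k + 1))ᶜ ∩ s'.Ω (k + 1)) Y
                    (Function.update (Function.update (baseCfg (k + 1) ((MeasurableEquiv.piEquivPiSubtypeProd (fun _ : PBond (F.P p.K) (k + 1) => SU N) (· ∈ (Set.toFinite (bondsIn (k + 1) (s'.Ω (k + 1))ᶜ)).toFinset)).symm q)) k (Function.updateFinset ((baseCfg (V := FluctV N) (k + 1) ((MeasurableEquiv.piEquivPiSubtypeProd (fun _ : PBond (F.P p.K) (k + 1) => SU N) (· ∈ (Set.toFinite (bondsIn (k + 1) (s'.Ω (k + 1))ᶜ)).toFinset)).symm q)) k).1 (Set.toFinite (bondsIn k (s'.Ω (k + 1))ᶜ)).toFinset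 y, ((baseCfg (V := FluctV N) (k + 1) ((MeasurableEquiv.piEquivPiSubtypeProd (fun _ : PBond (F.P p.K) (k + 1) => SU N) (· ∈ (Set.toFinite (bondsIn (k + 1) (s'.Ω (k + 1))ᶜ)).toFinset)).symm q)) k).2)) k (insA (Set.toFinite (bondsIn k ((s'.Λ (k + 1))ᶜ ∩ s'.Ω (k + 1)))).toFinset a ((Function.update (baseCfg (k + 1) ((MeasurableEquiv.piEquivPiSubtypeProd (fun _ : PBond (F.P p.K) (k + 1) => SU N) (· ∈ (Set.toFinite (bondsIn (k + 1) (s'.Ω (k + 1))ᶜ)).toFinset)).symm q)) k (Function.updateFinset ((baseCfg (V := FluctV N) (k + 1) ((MeasurableEquiv.piEquivPiSubtypeProd (fun _ : PBond (F.P p.K) (k + 1) => SU N) (· ∈ (Set.toFinite (bondsIn (k + 1) (s'.Ω (k + 1))ᶜ)).toFinset)).symm q)) k).1 (Set.toFinite (bondsIn k (s'.Ω (k + 1))ᶜ)).toFinset y, ((baseCfg (V := FluctV N) (k + 1) ((MeasurableEquiv.piEquivPiSubtypeProd (fun _ : PBond (F.P p.K) (k + 1) => SU N) (· ∈ (Set.toFinite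 (bondsIn (k + 1) (s'.Ω (k + 1))ᶜ)).toFinset)).symm q)) k).2)) k))) *
                tkBranchOfRecord F N (FluctV N) (rePinH θ).ν (rePinH θ).τ9.M (gOfRecord₁₃ F N (rePinH θ).toStage13Params p) p.K (WtOfRecord₁₃H F N (rePinH θ) p s') s'.init S₀ k
              (fun ω => (sect2Operand F N (FluctV N) p.K (settingOfRecord₁₃ F N (rePinH θ).toStage13Params p) ((rePinH θ).rzAt p s') s' t' E'
                  (UbgOfRecord₁₃CoP F N (rePinH θ).toStage13Params p (k + 1) s')) (Function.update S₀ (k + 1) Y, fun j => (ω j).2) (fun j => (ω j).1))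
                    (Function.update (Function.update (baseCfg (k + 1) ((MeasurableEquiv.piEquivPiSubtypeProd (fun _ : PBond (F.P p.K) (k + 1) => SU N) (· ∈ (Set.toFinite (bondsIn (k + 1) (s'.Ω (k + 1))ᶜ)).toFinset)).symm q)) k (Function.updateFinset ((baseCfg (V := FluctV N) (k + 1) ((MeasurableEquiv.piEquivPiSubtypeProd (fun _ : PBond (F.P p.K) (k + 1) => SU N) (· ∈ (Set.toFinite (bondsIn (k + 1) (s'.Ω (k + 1))ᶜ)).toFinset)).symm q)) k).1 (Set.toFinite (bondsIn k (s'.Ω (k + 1))ᶜ)).toFinset y, ((baseCfg (V := FluctV N) (k + 1) ((MeasurableEquiv.piEquivPiSubtypeProd (fun _ : PBond (F.P p.K) (k + 1) => SU N) (· ∈ (Set.toFinite (bondsIn (k + 1) (s'.Ω (k + 1))ᶜ)).toFinset)).symm q)) k).2)) k (insA (Set.toFinite (bondsIn k ((s'.Λ (k + 1))ᶜ ∩ s'.Ω (k + 1)))).toFinset a ((Function.update (baseCfg (k + 1) ((MeasurableEquiv.piEquivPiSubtypeProd (fun _ : PBond (F.P p.K) (k + 1) => SU N) (· ∈ (Set.toFinite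 (bondsIn (k + 1) (s'.Ω (k + 1))ᶜ)).toFinset)).symm q)) k (Function.updateFinset ((baseCfg (V := FluctV N) (k + 1) ((MeasurableEquiv.piEquivPiSubtypeProd (fun _ : PBond (F.P p.K) (k + 1) => SU N) (· ∈ (Set.toFinite (bondsIn (k + 1) (s'.Ω (k + 1))ᶜ)).toFinset)).symm q)) k).1 (Set.toFinite (bondsIn k (s'.Ω (k + 1))ᶜ)).toFinset y, ((baseCfg (V := FluctV N) (k + 1) ((MeasurableEquiv.piEquivPiSubtypeProd (fun _ : PBond (F.P p.K) (k + 1) => SU N) (· ∈ (Set.toFinite (bondsIn (k + 1) (s'.Ω (k + 1))ᶜ)).toFinset)).symm q)) k).2)) k)))) :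
    ∀ S₀ ∈ admSOfRecord F (rePinH θ).ν (rePinH θ).τ9.M (gOfRecord₁₃ F N (rePinH θ).toStage13Params p) p.K k s'.init, kernelTransport
        ((Measure.pi fun _ : ↥(Set.toFinite (bondsIn k (s'.Ω (k + 1))ᶜ)).toFinset => (HaarData.haar : Measure (SU N))).prod
          (Measure.pi fun _ : {b : PBond (F.P p.K) k // b ∉ (Set.toFinite (bondsIn k (s'.Ω (k + 1))ᶜ)).toFinset} => (HaarData.haar : Measure (SU N))))
        ((Measure.pi fun _ : ↥(Set.toFinite (bondsIn k (s'.Ω (k + 1))ᶜ)).toFinset => (HaarData.haar : Measure (SU N))).prod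
          (Measure.pi fun _ : {c : PBond (F.P p.K) (k + 1) // c ∉ (Set.toFinite (bondsIn (k + 1) (s'.Ω (k + 1))ᶜ)).toFinset} =>
            (HaarData.haar : Measure (SU N))))
        (fun q => (q.1, fun c : {c : PBond (F.P p.K) (k + 1) // c ∉ (Set.toFinite (bondsIn (k + 1) (s'.Ω (k + 1))ᶜ)).toFinset} =>
          (avOfRecord F N p.K k).avg
            ((MeasurableEquiv.piEquivPiSubtypeProd (fun _ : PBond (F.P p.K) k => SU N)
              (· ∈ (Set.toFinite (bondsIn k (s'.Ω (k + 1))ᶜ)).toFinset)).symm q) c))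
        ((fun U => wOfRecord₉ F N (rePinH θ).toStage9Params p (gOfRecord₁₃ F N (rePinH θ).toStage13Params p) k s' U ((avOfRecord F N p.K k).avg U) *
            (chiSeqOfRecord F N (rePinH θ).ν (rePinH θ).τ9.M (gOfRecord₁₃ F N (rePinH θ).toStage13Params p) p.K k s'.init U *
              tkBranchOfRecord F N (FluctV N) (rePinH θ).ν (rePinH θ).τ9.M (gOfRecord₁₃ F N (rePinH θ).toStage13Params p) p.K (WtOfRecord₁₃H F N (rePinH θ) p s'.init) s'.init S₀ k (fun ω => (sect2Operand F N (FluctV N) p.K (settingOfRecord₁₃ F N (rePinH θ).toStage13Params p) ((rePinH θ).rzAt p s'.init) s'.init (t s'.init) (Ek s'.init)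
            (UbgOfRecord₁₃CoP F N (rePinH θ).toStage13Params p k s'.init)) (S₀, fun j => (ω j).2) (fun j => (ω j).1)) (baseCfg k U))) ∘
          ⇑(MeasurableEquiv.piEquivPiSubtypeProd (fun _ : PBond (F.P p.K) k => SU N)
            (· ∈ (Set.toFinite (bondsIn k (s'.Ω (k + 1))ᶜ)).toFinset)).symm)
      =ᵐ[((Measure.pi fun _ : ↥(Set.toFinite (bondsIn k (s'.Ω (k + 1))ᶜ)).toFinset => (HaarData.haar : Measure (SU N))).prod
          (Measure.pi fun _ : {c : PBond (F.P p.K) (k + 1) // c ∉ (Set.toFinite (bondsIn (k + 1) (s'.Ω (k + 1))ᶜ)).toFinset} =>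
            (HaarData.haar : Measure (SU N))))]
        fun z => ∑ Y ∈ (Set.toFinite {Y : Set (Site (F.P p.K) 0) | Y ∈ SClassOfRecord F (rePinH θ).ν (gOfRecord₁₃ F N (rePinH θ).toStage13Params p) p.K (k + 1) ∧ Y ⊆ s'.Ω (k + 1) ∩ (s'.Λ (k + 1))ᶜ}).toFinset,
          zetaOp (genDataOfRecord F N (FluctV N) (rePinH θ).ν (rePinH θ).τ9.M (gOfRecord₁₃ F N (rePinH θ).toStage13Params p) p.K (WtOfRecord₁₃H F N (rePinH θ) p s') s' (Function.update S₀ (k + 1) Y) k).ζ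
            (aOp k (genDataOfRecord F N (FluctV N) (rePinH θ).ν (rePinH θ).τ9.M (gOfRecord₁₃ F N (rePinH θ).toStage13Params p) p.K (WtOfRecord₁₃H F N (rePinH θ) p s') s' (Function.update S₀ (k + 1) Y) k).sA
              (genDataOfRecord F N (FluctV N) (rePinH θ).ν (rePinH θ).τ9.M (gOfRecord₁₃ F N (rePinH θ).toStage13Params p) p.K (WtOfRecord₁₃H F N (rePinH θ) p s') s' (Function.update S₀ (k + 1) Y) k).w
              (tkBranchOfRecord F N (FluctV N) (rePinH θ).ν (rePinH θ).τ9.M (gOfRecord₁₃ F N (rePinH θ).toStage13Params p) p.K (WtOfRecord₁₃H F N (rePinH θ) p s') s'.init S₀ k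
                (fun ω => (sect2Operand F N (FluctV N) p.K (settingOfRecord₁₃ F N (rePinH θ).toStage13Params p) ((rePinH θ).rzAt p s') s' t' E'
                  (UbgOfRecord₁₃CoP F N (rePinH θ).toStage13Params p (k + 1) s')) (Function.update S₀ (k + 1) Y, fun j => (ω j).2) (fun j => (ω j).1))))
            (Function.update (baseCfg (k + 1) ((MeasurableEquiv.piEquivPiSubtypeProd (fun _ : PBond (F.P p.K) (k + 1) => SU N)
              (· ∈ (Set.toFinite (bondsIn (k + 1) (s'.Ω (k + 1))ᶜ)).toFinset)).symm (avgRestrOfRecord F N p.K k (Set.toFinite (bondsIn k (s'.Ω (k + 1))ᶜ)).toFinset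
                (Set.toFinite (bondsIn (k + 1) (s'.Ω (k + 1))ᶜ)).toFinset z.1, z.2))) k
            (Function.updateFinset ((baseCfg (V := FluctV N) (k + 1) ((MeasurableEquiv.piEquivPiSubtypeProd (fun _ : PBond (F.P p.K) (k + 1) => SU N)
              (· ∈ (Set.toFinite (bondsIn (k + 1) (s'.Ω (k + 1))ᶜ)).toFinset)).symm (avgRestrOfRecord F N p.K k (Set.toFinite (bondsIn k (s'.Ω (k + 1))ᶜ)).toFinset
                (Set.toFinite (bondsIn (k + 1) (s'.Ω (k + 1))ᶜ)).toFinset z.1, z.2))) k).1 (Set.toFinite (bondsIn k (s'.Ω (k + 1))ᶜ)).toFinset z.1,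
              ((baseCfg (V := FluctV N) (k + 1) ((MeasurableEquiv.piEquivPiSubtypeProd (fun _ : PBond (F.P p.K) (k + 1) => SU N)
              (· ∈ (Set.toFinite (bondsIn (k + 1) (s'.Ω (k + 1))ᶜ)).toFinset)).symm (avgRestrOfRecord F N p.K k (Set.toFinite (bondsIn k (s'.Ω (k + 1))ᶜ)).toFinset
                (Set.toFinite (bondsIn (k + 1) (s'.Ω (k + 1))ᶜ)).toFinset z.1, z.2))) k).2)) :=
  oldBranchCondExp₁₃H_of_fluctuationSlices_rePinH_of_termRows θ h p hkK (hdec := hdec) (hdec' := hdec') hk s' hform hT t' E' κ₂ hΨ hJ hpush hfib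
    (fun q hqS => by
      by_contra hw
      obtain ⟨_, -, hall⟩ := support_of_wOfRecord_ne_zero (rePinH θ).ν (rePinH θ).τ9.M (rePinH θ).A₁ (rePinH θ).ζ p (gOfRecord₁₃ F N (rePinH θ).toStage13Params p) k hD s' _ _ hw
      exact hqS (hbridge q hall))
    htrows₀ htrows hIslice hslice

end Summit.QuantumFields.YangMills.Theorems.BalabanUVNodesN11OldBranchCondExpOfFluctuationSlicesAtRePinHOfSupport

end
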